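import Summits.ResolutionOfSingularities.ResolutionOfSingularities.Theorems.MaxContactCutExitLaw
import HarnessLib

/-!
# PlanarCutStates — decomp-res node «PlanarCut» (lens-5 g18 rev 1), tree file 1/5: STATE LEVEL
§1 exponent statistics of a finite set of exponents (the STRICT MULTIPLICITY of a wall layer); §2 the three
indices; §3 the coefficient
formula of a PLANAR move (`coeff_pointTransform_planar`: chart `u_j`, translation only in `u_i`, wall `u_k`
respected — each `u_k`-layer
moves separately by the two-variable blow-up rule); §4 wall layers and their transport under a planar move (state
level).  All PROVED.

Content VERBATIM from the decomp-res lens-5 g18 file `HOME/decomp-res-lens-5/g18/parts/PlanarCut-REV1-155d4ffb.lean`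
(sha256 155d4ffbaf2b8fc3; the REV1
pin the critic graded, CRITIC-LEDGER rows 119 + 119a CLEARED: DECIDED +1 · MAP +1; supersedes the NODE pin b3c721b9).  HOME =
run/shared/lean/pub/decomp-res.  Host: route `MaxContactCut`, aside 31770 `MaxContactCut.DefectWalksDeep` BY NAME
through the tree's
`ExitLaw.defectWalksDeep_iff_joint'` (`Theorems/MaxContactCutExitLaw`).

[WRITER NOTE (decomp-res writer g6): the lens file is split into `PlanarCutStates` (§1–§4 state level) →
`PlanarCutRows` (the Taylor row of a
layer) → `PlanarCutMoves` (strict-multiplicity inequalities, dead layers) → `PlanarCutWalks` (§5 walk level: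
potential, descent, kill) →
`MaxContactCutPlanarCut` (§6/§6b classes + `closes` BY NAME); `set_option` lines dropped; §7 adapters (VERBATIM
restatements of lens-5 g17
`TransportCut` / lens-3 g15 `ConeCut` classes) are NOT landed here — they follow once `Theorems/TransportCut*` /
`ConeCut*` are in the tree
(critic row 119: import, do not duplicate).  All files sit inside the Theses cone (the exit-law walk model
`ExitLawStates` imports the
route's itinerary model), so the §6 classes are booked as TREE THEOREMS / docstrings, not as route asides.]
(Sources: Hauser2010 §§D–G; HauserPerlega2019; CossartJannsenSaito2020 Thm. 2.14; CossartPiltant2019; Moh1987.)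
-/

noncomputable section

open MvPolynomial Finset
open Literature.AlgebraicGeometry.Resolution
open Literature.AlgebraicGeometry.Resolution.Hauser2010
open Literature.AlgebraicGeometry.Resolution.PointBlowup
open Literature.AlgebraicGeometry.Resolution.WeightedBlowup
open Summit.ResolutionOfSingularities.ResolutionOfSingularities.Theses
open Summit.ResolutionOfSingularities.ResolutionOfSingularities.Theorems.TightDefectClasses
open Summit.ResolutionOfSingularities.ResolutionOfSingularities.Theorems.TightDefectStrongWalks
open Summit.ResolutionOfSingularities.ResolutionOfSingularities.Theorems.ItineraryCutClasses
open Summit.ResolutionOfSingularities.ResolutionOfSingularities.Theorems.BoundaryLedger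
open Summit.ResolutionOfSingularities.ResolutionOfSingularities.Theorems.ProximityCut
open Summit.ResolutionOfSingularities.ResolutionOfSingularities.Theorems.ExitLaw

namespace Summit.ResolutionOfSingularities.ResolutionOfSingularities.Theorems.PlanarCut

/-! ## §1 Exponent statistics of a finite set of exponents (the strict multiplicity of a wall layer) -/

section Stats

/-- The least `u_l`-exponent over `S` (`0` for `S = ∅`).  DEFINITION (support). -/
noncomputable def lo (S : Finset (Fin 3 →₀ ℕ)) (l : Fin 3) : ℕ :=
  if h : S.Nonempty then S.inf' h (fun d => d l) else 0

/-- The least `u_i u_j`-degree `d_i + d_j` over `S` (`0` for `S = ∅`).  DEFINITION (support). -/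
noncomputable def loSum (S : Finset (Fin 3 →₀ ℕ)) (i j : Fin 3) : ℕ :=
  if h : S.Nonempty then S.inf' h (fun d => d i + d j) else 0

/-- The STRICT MULTIPLICITY of a set of exponents in the plane coordinates `u_i, u_j`: the order of the layer after its
monomial content `u_i^{lo i} u_j^{lo j}` is removed, `min (d_i + d_j) − min d_i − min d_j` (the multiplicity at the
origin of the strict transform of the plane curve the layer defines; `0` iff the layer is MONOMIAL-LED).
DEFINITION (the node's new controlling quantity). -/
noncomputable def sm (S : Finset (Fin 3 →₀ ℕ)) (i j : Fin 3) : ℕ :=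
  loSum S i j - lo S i - lo S j

variable {S : Finset (Fin 3 →₀ ℕ)}

/-- `lo_le`: Auxiliary step of this node's calculus, VERBATIM from the lens file (see the module docstring); the
statement is its type. [folklore] -/
theorem lo_le {d : Fin 3 →₀ ℕ} (hd : d ∈ S) (l : Fin 3) : lo S l ≤ d l := by
  unfold lo
  rw [dif_pos ⟨d, hd⟩]
  exact Finset.inf'_le _ hd

/-- `exists_lo_eq`: Auxiliary step of this node's calculus, VERBATIM from the lens file (see the module docstring);
the statement is its type. [folklore] -/
theorem exists_lo_eq (h : S.Nonempty) (l : Fin 3) : ∃ d ∈ S, d l = lo S l := by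
  unfold lo
  rw [dif_pos h]
  obtain ⟨d, hd, h'⟩ := Finset.exists_mem_eq_inf' h (fun d : Fin 3 →₀ ℕ => d l)
  exact ⟨d, hd, h'.symm⟩

/-- `loSum_le`: Auxiliary step of this node's calculus, VERBATIM from the lens file (see the module docstring); the
statement is its type. [folklore] -/
theorem loSum_le {d : Fin 3 →₀ ℕ} (hd : d ∈ S) (i j : Fin 3) : loSum S i j ≤ d i + d j := by
  unfold loSum
  rw [dif_pos ⟨d, hd⟩]
  exact Finset.inf'_le (fun d : Fin 3 →₀ ℕ => d i + d j) hd

/-- `exists_loSum_eq`: Auxiliary step of this node's calculus, VERBATIM from the lens file (see the module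
docstring); the statement is its type. [folklore] -/
theorem exists_loSum_eq (h : S.Nonempty) (i j : Fin 3) : ∃ d ∈ S, d i + d j = loSum S i j := by
  unfold loSum
  rw [dif_pos h]
  obtain ⟨d, hd, h'⟩ := Finset.exists_mem_eq_inf' h (fun d : Fin 3 →₀ ℕ => d i + d j)
  exact ⟨d, hd, h'.symm⟩

/-- `lo_add_lo_le_loSum`: Auxiliary step of this node's calculus, VERBATIM from the lens file (see the module
docstring); the statement is its type. [folklore] -/
theorem lo_add_lo_le_loSum (i j : Fin 3) : lo S i + lo S j ≤ loSum S i j := by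
  by_cases h : S.Nonempty
  · obtain ⟨d, hd, hd'⟩ := exists_loSum_eq h i j
    have h1 := lo_le hd i
    have h2 := lo_le hd j
    omega
  · unfold lo loSum
    rw [dif_neg h, dif_neg h, dif_neg h]

/-- `loSum_comm`: Auxiliary step of this node's calculus, VERBATIM from the lens file (see the module docstring);
the statement is its type. [folklore] -/
theorem loSum_comm (i j : Fin 3) : loSum S i j = loSum S j i := by
  unfold loSum
  split_ifs with h
  · exact congrArg _ (funext fun d => add_comm _ _)
  · rfl

/-- `sm_comm`: Auxiliary step of this node's calculus, VERBATIM from the lens file (see the module docstring); the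
statement is its type. [folklore] -/
theorem sm_comm (i j : Fin 3) : sm S i j = sm S j i := by
  unfold sm
  rw [loSum_comm]
  omega

/-- `sm_empty`: Auxiliary step of this node's calculus, VERBATIM from the lens file (see the module docstring); the
statement is its type. [folklore] -/
theorem sm_empty (i j : Fin 3) : sm (∅ : Finset (Fin 3 →₀ ℕ)) i j = 0 := by
  unfold sm loSum
  rw [dif_neg (by simp)]
  simp

/-- `le` criterion for `lo`: a lower bound valid on every element bounds `lo` from below. [folklore] -/
theorem le_lo (h : S.Nonempty) {l : Fin 3} {m : ℕ} (hm : ∀ d ∈ S, m ≤ d l) : m ≤ lo S l := by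
  obtain ⟨d, hd, hd'⟩ := exists_lo_eq h l
  rw [← hd']
  exact hm d hd

/-- `le_loSum`: Auxiliary step of this node's calculus, VERBATIM from the lens file (see the module docstring); the
statement is its type. [folklore] -/
theorem le_loSum (h : S.Nonempty) {i j : Fin 3} {m : ℕ} (hm : ∀ d ∈ S, m ≤ d i + d j) : m ≤ loSum S i j := by
  obtain ⟨d, hd, hd'⟩ := exists_loSum_eq h i j
  rw [← hd']
  exact hm d hd

end Stats

/-! ## §2 Three indices -/

section Fin3

/-- Two distinct indices and a third avoiding both exhaust `Fin 3` (hypotheses bundled; the unbundled form is the tree's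
`Literature.Topology.FourManifolds.Fin.eq_or_eq_or_eq_of_ne`, not imported here to keep this chain's import graph
inside the resolution
library). [folklore] -/
theorem fin3_cases {i j k : Fin 3} (h : i ≠ j ∧ j ≠ k ∧ i ≠ k) (l : Fin 3) : l = i ∨ l = j ∨ l = k := by
  obtain ⟨hij, hjk, hik⟩ := h
  revert i j k l
  decide

/-- The third index. [folklore] -/
theorem fin3_third (j k : Fin 3) (hjk : j ≠ k) : ∃ i : Fin 3, i ≠ j ∧ i ≠ k := by
  revert j k
  decide

/-- `univ_eq_three`: Auxiliary step of this node's calculus, VERBATIM from the lens file (see the module docstring);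
the statement is its type. [folklore] -/
theorem univ_eq_three {i j k : Fin 3} (hij : i ≠ j) (hjk : j ≠ k) (hik : i ≠ k) :
    (Finset.univ : Finset (Fin 3)) = {i, j, k} := by
  ext l
  simp only [Finset.mem_univ, Finset.mem_insert, Finset.mem_singleton, true_iff]
  exact fin3_cases ⟨hij, hjk, hik⟩ l

/-- `prod_three`: Auxiliary step of this node's calculus, VERBATIM from the lens file (see the module docstring);
the statement is its type. [folklore] -/
theorem prod_three {M : Type*} [CommMonoid M] {i j k : Fin 3} (hij : i ≠ j) (hjk : j ≠ k) (hik : i ≠ k)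
    (f : Fin 3 → M) : ∏ l, f l = f i * f j * f k := by
  rw [univ_eq_three hij hjk hik, Finset.prod_insert (by simp [hij, hik]), Finset.prod_insert (by simp [hjk]),
    Finset.prod_singleton, mul_assoc]

/-- `degree_three`: Auxiliary step of this node's calculus, VERBATIM from the lens file (see the module docstring);
the statement is its type. [folklore] -/
theorem degree_three {i j k : Fin 3} (hij : i ≠ j) (hjk : j ≠ k) (hik : i ≠ k) (d : Fin 3 →₀ ℕ) :
    d.degree = d i + d j + d k := by
  rw [Finsupp.degree_eq_sum, univ_eq_three hij hjk hik, Finset.sum_insert (by simp [hij, hik]),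
    Finset.sum_insert (by simp [hjk]), Finset.sum_singleton, add_assoc]

/-- `finsupp_ext_three`: Auxiliary step of this node's calculus, VERBATIM from the lens file (see the module
docstring); the statement is its type. [folklore] -/
theorem finsupp_ext_three {i j k : Fin 3} (hij : i ≠ j) (hjk : j ≠ k) (hik : i ≠ k) {d d' : Fin 3 →₀ ℕ}
    (hi : d i = d' i) (hj : d j = d' j) (hk : d k = d' k) : d = d' := by
  ext l
  rcases fin3_cases ⟨hij, hjk, hik⟩ l with rfl | rfl | rfl
  · exact hi
  · exact hj
  · exact hk

/-- The exponent `u_i^x u_j^y u_k^a`. DEFINITION (support). -/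
noncomputable def exp3 (i j k : Fin 3) (x y a : ℕ) : Fin 3 →₀ ℕ :=
  Finsupp.single i x + Finsupp.single j y + Finsupp.single k a

/-- `exp3_i`: Auxiliary step of this node's calculus, VERBATIM from the lens file (see the module docstring); the
statement is its type. [folklore] -/
theorem exp3_i {i j k : Fin 3} (hij : i ≠ j) (hik : i ≠ k) (x y a : ℕ) : exp3 i j k x y a i = x := by
  simp [exp3, Finsupp.single_eq_of_ne hij, Finsupp.single_eq_of_ne hik]

/-- `exp3_j`: Auxiliary step of this node's calculus, VERBATIM from the lens file (see the module docstring); the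
statement is its type. [folklore] -/
theorem exp3_j {i j k : Fin 3} (hij : i ≠ j) (hjk : j ≠ k) (x y a : ℕ) : exp3 i j k x y a j = y := by
  simp [exp3, Finsupp.single_eq_of_ne hij.symm, Finsupp.single_eq_of_ne hjk]

/-- `exp3_k`: Auxiliary step of this node's calculus, VERBATIM from the lens file (see the module docstring); the
statement is its type. [folklore] -/
theorem exp3_k {i j k : Fin 3} (hjk : j ≠ k) (hik : i ≠ k) (x y a : ℕ) : exp3 i j k x y a k = a := by
  simp [exp3, Finsupp.single_eq_of_ne hik.symm, Finsupp.single_eq_of_ne hjk.symm]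

end Fin3

/-! ## §3 The coefficient formula of a PLANAR move (chart `u_j`, translation only in `u_i`, wall `u_k` kept) -/

section Planar

variable {K : Type} [Field K] [DecidableEq K]

omit [DecidableEq K] in
/-- A binomial factor at an untranslated variable: `C(m,n)·0^{m−n} = [m = n]`. [folklore] -/
theorem choose_mul_zero_pow (m n : ℕ) : ((m.choose n : ℕ) : K) * (0 : K) ^ (m - n) = if m = n then 1 else 0 := by
  rcases lt_trichotomy m n with h | rfl | h
  · rw [Nat.choose_eq_zero_of_lt h, Nat.cast_zero, zero_mul, if_neg (by omega)]
  · rw [Nat.choose_self, Nat.sub_self, pow_zero, Nat.cast_one, one_mul, if_pos rfl]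
  · rw [zero_pow (by omega), mul_zero, if_neg (by omega)]

variable {i j k : Fin 3} (hij : i ≠ j) (hjk : j ≠ k) (hik : i ≠ k)
include hij hjk hik

omit [DecidableEq K] in
/-- **COEFFICIENT FORMULA OF A PLANAR MOVE (PROVED).**  For `b_j = b_k = 0` (chart `u_j`, the wall `u_k = 0` kept,
translation `u_i ↦ u_i + b_i`) and `F` of order `≥ q`:
`coeff_{d'} F(…)' = Σ_{d : d_k = d'_k, |d| = d'_j + q} coeff_d F · C(d_i, d'_i) · b_i^{d_i − d'_i}` — the `u_k`-LAYERS
DO NOT MIX and each evolves by the two-variable rule. [new] [folklore] -/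
theorem coeff_pointTransform_planar (q : ℕ) (b : Fin 3 → K) (hbj : b j = 0) (hbk : b k = 0)
    (F : MvPolynomial (Fin 3) K) (hF : ∀ d ∈ F.support, q ≤ d.degree) (d' : Fin 3 →₀ ℕ) :
    coeff d' (translate b (chartTransform q j F)) =
      ∑ d ∈ F.support with (d k = d' k ∧ d.degree = d' j + q),
        coeff d F * ((((d i).choose (d' i) : ℕ) : K) * b i ^ (d i - d' i)) := by
  classical
  unfold chartTransform
  rw [translate_finset_sum, coeff_sum, Finset.sum_filter]
  refine Finset.sum_congr rfl fun d hd => ?_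
  rw [coeff_translate_monomial, prod_three hij hjk hik]
  have hci : chartExponent q j d i = d i := by
    have := congrArg (fun c : Fin 3 →₀ ℕ => c i) (chartExponent_erase q j d)
    simp only [Finsupp.erase_ne hij] at this
    exact this
  have hck : chartExponent q j d k = d k := by
    have := congrArg (fun c : Fin 3 →₀ ℕ => c k) (chartExponent_erase q j d)
    simp only [Finsupp.erase_ne hjk.symm] at this
    exact this
  rw [hci, hck, chartExponent_self, hbj, hbk, choose_mul_zero_pow, choose_mul_zero_pow]
  have hq := hF d hd
  by_cases h1 : d k = d' k
  · by_cases h2 : d.degree = d' j + q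
    · rw [if_pos (by omega), if_pos h1, if_pos ⟨h1, h2⟩, mul_one, mul_one]
    · rw [if_neg (by omega), mul_zero, zero_mul, mul_zero, if_neg (fun h => h2 h.2)]
  · rw [if_neg h1, mul_zero, mul_zero, if_neg (fun h => h1 h.1)]

/-! ## §4 Wall layers and their transport under a planar move (state level) -/

/-- The `u_k`-LAYER `a` of `F`: the exponents `d` of `F` with `d_k = a`.  DEFINITION (support). -/
noncomputable def layer (k : Fin 3) (a : ℕ) (F : MvPolynomial (Fin 3) K) : Finset (Fin 3 →₀ ℕ) :=
  F.support.filter (fun d => d k = a)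

omit hij hjk hik [DecidableEq K] in
/-- `mem_layer`: Auxiliary step of this node's calculus, VERBATIM from the lens file (see the module docstring); the
statement is its type. [folklore] -/
theorem mem_layer {k : Fin 3} {a : ℕ} {F : MvPolynomial (Fin 3) K} {d : Fin 3 →₀ ℕ} :
    d ∈ layer k a F ↔ coeff d F ≠ 0 ∧ d k = a := by
  unfold layer
  rw [Finset.mem_filter, MvPolynomial.mem_support_iff]

omit hij hjk hik in
/-- An exponent with `0 < d_k < q` is not a `q`-th power exponent: cleaning never touches the layers `1 … q−1`.
[folklore] -/
theorem not_isPthPowerExponent_of_layer {q a : ℕ} (ha1 : 1 ≤ a) (haq : a < q) {d : Fin 3 →₀ ℕ} (hd : d k = a) :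
    ¬ IsPthPowerExponent q d := by
  rw [isPthPowerExponent_iff]
  intro h
  have := Nat.le_of_dvd (by omega) (hd ▸ h k)
  omega

omit hij hjk hik in
/-- Coefficients of the stepped state in the layers `1 … q−1` are those of the point transform. [folklore] -/
theorem coeff_step_of_layer (q : ℕ) (j : Fin 3) (b : Fin 3 → K) (s : State (Fin 3) K) {a : ℕ} (ha1 : 1 ≤ a)
    (haq : a < q) {d : Fin 3 →₀ ℕ} (hd : d k = a) :
    coeff d (step q j b s).F = coeff d (translate b (chartTransform q j s.F)) := by
  classical
  show coeff d (deletePthPowers q (pointTransform q j b s)) = _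
  rw [coeff_deletePthPowers, if_neg (not_isPthPowerExponent_of_layer ha1 haq hd)]
  rfl

omit hij hjk hik in
/-- A non-zero coefficient of the stepped state is a non-zero coefficient of the point transform (cleaning only
deletes). [folklore] -/
theorem coeff_pointTransform_ne_zero_of_step (q : ℕ) (j : Fin 3) (b : Fin 3 → K) (s : State (Fin 3) K)
    {d : Fin 3 →₀ ℕ} (hd : coeff d (step q j b s).F ≠ 0) :
    coeff d (translate b (chartTransform q j s.F)) ≠ 0 := by
  classical
  change coeff d (deletePthPowers q (pointTransform q j b s)) ≠ 0 at hd
  rw [coeff_deletePthPowers] at hd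
  split_ifs at hd with h
  · exact absurd rfl hd
  · exact hd

/-- **LAYER ORIGIN (PROVED).**  Under a planar move every exponent `d'` of layer `a` of the new state comes from an
exponent `d` of layer `a` of the old one on the line `d_i + d_j + a = d'_j + q`, with `d'_i ≤ d_i`, and `d'_i = d_i`
when the move is untranslated. [new] [folklore] -/
theorem origin_of_mem_layer_step (q : ℕ) (b : Fin 3 → K) (hbj : b j = 0) (hbk : b k = 0) (s : State (Fin 3) K)
    (hF : ∀ d ∈ s.F.support, q ≤ d.degree) {a : ℕ} {d' : Fin 3 →₀ ℕ} (hd' : d' ∈ layer k a (step q j b s).F) :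
    ∃ d ∈ layer k a s.F, d i + d j + a = d' j + q ∧ d' i ≤ d i ∧ (b i = 0 → d' i = d i) := by
  classical
  rw [mem_layer] at hd'
  obtain ⟨hc, hdk⟩ := hd'
  have h1 := coeff_pointTransform_ne_zero_of_step q j b s hc
  rw [coeff_pointTransform_planar hij hjk hik q b hbj hbk s.F hF d'] at h1
  obtain ⟨d, hd, hne⟩ := Finset.exists_ne_zero_of_sum_ne_zero h1
  rw [Finset.mem_filter] at hd
  obtain ⟨hdF, hdk', hdeg⟩ := hd
  have hle : d' i ≤ d i := by
    by_contra hlt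
    push Not at hlt
    apply hne
    rw [Nat.choose_eq_zero_of_lt hlt, Nat.cast_zero, zero_mul, mul_zero]
  refine ⟨d, mem_layer.mpr ⟨MvPolynomial.mem_support_iff.mp hdF, by omega⟩, ?_, hle, ?_⟩
  · have := degree_three hij hjk hik d
    omega
  · intro hbi
    by_contra hne'
    apply hne
    rw [hbi, zero_pow (by omega), mul_zero, mul_zero]

/-- An empty layer stays empty. [folklore] -/
theorem layer_step_eq_empty (q : ℕ) (b : Fin 3 → K) (hbj : b j = 0) (hbk : b k = 0) (s : State (Fin 3) K)
    (hF : ∀ d ∈ s.F.support, q ≤ d.degree) {a : ℕ} (h : layer k a s.F = ∅) : layer k a (step q j b s).F = ∅ := by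
  by_contra hne
  obtain ⟨d', hd'⟩ := Finset.nonempty_iff_ne_empty.mpr hne
  obtain ⟨d, hd, -⟩ := origin_of_mem_layer_step hij hjk hik q b hbj hbk s hF hd'
  rw [h] at hd
  exact absurd hd (Finset.notMem_empty d)

omit hij hik in
/-- **FORWARD TRANSPORT at an untranslated move (PROVED):** the chart exponent of a layer exponent is a layer exponent
of the new state (layers `1 … q−1`). [folklore] -/
theorem chartExponent_mem_layer_step (q : ℕ) (s : State (Fin 3) K) (hF : ∀ d ∈ s.F.support, q ≤ d.degree)
    {a : ℕ} (ha1 : 1 ≤ a) (haq : a < q) {d : Fin 3 →₀ ℕ} (hd : d ∈ layer k a s.F) :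
    chartExponent q j d ∈ layer k a (step q j (0 : Fin 3 → K) s).F := by
  classical
  rw [mem_layer] at hd ⊢
  have hck : chartExponent q j d k = d k := by
    have := congrArg (fun c : Fin 3 →₀ ℕ => c k) (chartExponent_erase q j d)
    simp only [Finsupp.erase_ne hjk.symm] at this
    exact this
  refine ⟨?_, by rw [hck, hd.2]⟩
  rw [coeff_step_of_layer q j 0 s ha1 haq (by rw [hck, hd.2]), translate_zero_eq,
    coeff_chartTransform_chartExponent s.F hF (MvPolynomial.mem_support_iff.mpr hd.1)]
  exact hd.1

omit hjk hik in
/-- `chartExponent_i`: Auxiliary step of this node's calculus, VERBATIM from the lens file (see the module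
docstring); the statement is its type. [folklore] -/
theorem chartExponent_i (q : ℕ) (d : Fin 3 →₀ ℕ) : chartExponent q j d i = d i := by
  have := congrArg (fun c : Fin 3 →₀ ℕ => c i) (chartExponent_erase q j d)
  simp only [Finsupp.erase_ne hij] at this
  exact this

omit hij hik in
/-- `chartExponent_k`: Auxiliary step of this node's calculus, VERBATIM from the lens file (see the module
docstring); the statement is its type. [folklore] -/
theorem chartExponent_k (q : ℕ) (d : Fin 3 →₀ ℕ) : chartExponent q j d k = d k := by
  have := congrArg (fun c : Fin 3 →₀ ℕ => c k) (chartExponent_erase q j d)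
  simp only [Finsupp.erase_ne hjk.symm] at this
  exact this

end Planar

end Summit.ResolutionOfSingularities.ResolutionOfSingularities.Theorems.PlanarCut
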